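import Literature.AlgebraicGeometry.Frobenioids.Cor411iiBiratApexSetting
import Literature.AlgebraicGeometry.Frobenioids.BiratDivIdentityTransportWeak
import HarnessLib

/-!
# Frobenioids I, Corollary 4.11 (ii) AS TYPED in the reduced case (perfect, isotropic type) — for WEAKLY
# perf-factorial divisor monoids; and over the CLAUSES of the setting of the proof of Theorem 4.2

Mochizuki, *The geometry of Frobenioids I: the general theory*, Kyushu J. Math. **62** (2008) 293–400, Cor. 4.11 (ii)
p. 91, proof pp. 92–94 [cite: MochizukiFrdI2008, Cor. 4.11 (ii) p.91]; the reductions "we may assume without loss of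
generality that `C₁, C₂` are of isotropic type … not of group-like type" (p. 92) and "by passing to perfections" (proof
of Thm. 4.2, p. 78; of Thm. 4.9, p. 89); the step p. 93 ll. 42–46 ("by Theorem 4.2, (ii) [cf. also the fact that the
`Φ_i` are perf-factorial and non-dilating] … `Ψ^birat` preserves the base-identity endomorphisms").

PROOF-ONLY file (cell abc-iut, layer L1, node `FrdI:Cor4.11(ii)`; seat abc-iut-L1-t12, row «C411ii-WEAK» = the [FrdI]
Cor. 4.11 (ii) chain over `IsPerfFactorialWeak`, file (B)).  WEAK-HYPOTHESIS TWINS of `Cor411iiBiratApex.lean` (apex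
of sub-DAG S2, seat abc-iut-L1-d6) and of `Cor411iiBiratApexSetting.lean`, with "`Φ_i` perf-factorial" (Def. 2.4 (i)
(a)–(d)) WEAKENED to "`Φ_i` weakly perf-factorial" (`IsPerfFactorialWeak` = (a)(b)(c) + (d_ord) + (d_res), seat
abc-iut-L1-t2; cell finding F-L2d2-1: (d) fails for `Φ₀(Y^log) ⊇ ∏_J ℤ_{≥0}` of [EtTh] §3):
* `PreFrobenioid.exists_base_equivalence_inst_of_perfect_weak` / `PreFrobenioid.cor411ii_inst_of_perfect_weak` — for
  Frobenioids of PERFECT and isotropic type with `Φ_i` weakly perf-factorial and non-dilating, the birationalizations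
  Frobenioids (Prop. 4.4 (ii)), bases of FSMFF-type Div-slim, and `Ψ`, `Ψ⁻¹` with the conclusions of Thm. 3.4 (ii)(iii)
  and Thm. 4.2 (i): the base equivalence `Ψ^Base` under `Ψ`, and the typed `Cor411ii`.  ASSEMBLY VERBATIM as in the
  strong file — `E := Ψ^birat` (Cor. 4.10), `E^{±1}` carry base-identity endomorphisms to `Φ`-identity ones (NOW by
  `Birat.pull_base_mapOfEquiv_map_eq_id'_weak`, file (A) — the ONLY place the divisor-monoid hypothesis enters), hence
  to base-identity ones (Div-slimness, `isBaseIdentity_map_of_isDivSlim`), then `exists_base_equivalence_of_birat` /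
  `cor411ii_of_exists_base_equivalence'` (no `Φ`-hypothesis);
* `FrdI.T42.exists_base_equivalence_inst_of_clauses_weak` / `FrdI.T42.cor411ii_inst_of_clauses_weak` — the same over
  the CLAUSES of `FrdI.T42.Setting` (seat abc-iut-L1-t14: Frobenioids of perfect + isotropic type, the conclusions of
  Thm. 3.4 (ii)(iii) for `Ψ`, `Ψ⁻¹` incl. Frobenius degrees) passed as EXPLICIT binders with the perf-factorial clause
  weakened — the frozen structure `FrdI.T42.Setting` keeps its printed `perfFactorial_i` fields and is NOT twinned;
  "linear" = Frobenius degree `1` and "base-isomorphism" = Frobenius type ≫ pre-step (Prop. 1.7 (ii)) reduce the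
  remaining clauses exactly as in `FrdI.T42.exists_base_equivalence_inst_of_setting`.
The printed case is the strong files themselves (equivalently these theorems at `fun X => (hpf_i X).weak`).  No new
definitions; no landed declaration touched; a named hypothesis WEAKENED, nothing of the paper restated or strengthened;
nothing here is specific to the abc programme.  HONEST FRAMING: classical [FrdI] §4; nothing here bears on [IUTchIII]
Cor. 3.12.
-/

namespace Literature.AlgebraicGeometry.Frobenioids

open CategoryTheory Opposite

universe w v v' u u'

namespace PreFrobenioid

variable {D₁ : Type u} [Category.{v} D₁] {Φ₁ : D₁ᵒᵖ ⥤ CommMonCat.{w}}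
  {C₁ : Type u'} [Category.{v'} C₁] {F₁ : C₁ ⥤ ElemFrobenioid Φ₁}
  {D₂ : Type u} [Category.{v} D₂] {Φ₂ : D₂ᵒᵖ ⥤ CommMonCat.{w}}
  {C₂ : Type u'} [Category.{v'} C₂] {F₂ : C₂ ⥤ ElemFrobenioid Φ₂}

set_option backward.isDefEq.respectTransparency false in
/-- **[FrdI] Cor. 4.11 (ii), the base square in the perfect isotropic case, for WEAKLY perf-factorial `Φ_i`**
(proof p. 93 l. 30 – p. 94 l. 7): for Frobenioids `C_i → F_{Φ_i}` of perfect and isotropic type with `Φ_i` weakly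
perf-factorial and non-dilating, whose birationalizations carry Frobenioid structures over the zero monoids
(Prop. 4.4 (ii), `hB_i`), over bases of FSMFF-type that are Div-slim, and an equivalence `Ψ` such that `Ψ`, `Ψ⁻¹`
satisfy the conclusions of Thm. 3.4 (ii)(iii) (pre-steps, Frobenius type, linear morphisms, base-isomorphisms,
pull-backs) and Thm. 4.2 (i) (primary pre-steps): there is an equivalence `Ψ^Base : D₁ ⥲ D₂` with
`Base₂ ∘ Ψ ≅ Ψ^Base ∘ Base₁`.  ASSEMBLY as in `exists_base_equivalence_inst_of_perfect`: `E := Ψ^birat` (Cor. 4.10);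
`E`, `E⁻¹` carry base-identity endomorphisms to `Φ`-identity ones (`Birat.pull_base_mapOfEquiv_map_eq_id'_weak`: Thm.
4.2 (ii) + weakly perf-factorial + non-dilating), hence to base-identity ones (Div-slimness), then
`exists_base_equivalence_of_birat`. [cite: MochizukiFrdI2008, Cor. 4.11 (ii) p.91] -/
theorem exists_base_equivalence_inst_of_perfect_weak (hF₁ : IsFrobenioid F₁) (hsq₁ : HasBiratSquares F₁)
    (hF₂ : IsFrobenioid F₂) (hsq₂ : HasBiratSquares F₂) (Ψ : C₁ ≌ C₂)
    (hB₁ : IsFrobenioid (Birat.toElemZero hF₁ hsq₁)) (hB₂ : IsFrobenioid (Birat.toElemZero hF₂ hsq₂))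
    (hD₁ : IsOfFSMFFType D₁) (hD₂ : IsOfFSMFFType D₂)
    (hperf₁ : IsOfPerfectType F₁) (hperf₂ : IsOfPerfectType F₂)
    (hiso₁ : IsOfIsotropicType F₁) (hiso₂ : IsOfIsotropicType F₂)
    (hpf₁ : Objectwise (fun M _ => IsPerfFactorialWeak M) Φ₁)
    (hpf₂ : Objectwise (fun M _ => IsPerfFactorialWeak M) Φ₂)
    (hnd₁ : IsNonDilatingOn Φ₁) (hnd₂ : IsNonDilatingOn Φ₂)
    (hds₁ : (PreFrobenioidData.ofFunctor Φ₁ F₁).IsDivSlim) (hds₂ : (PreFrobenioidData.ofFunctor Φ₂ F₂).IsDivSlim)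
    (hpre : ∀ ⦃X Y : C₁⦄ (φ : X ⟶ Y), IsPreStep F₁ φ → IsPreStep F₂ (Ψ.functor.map φ))
    (hpre' : ∀ ⦃X Y : C₂⦄ (φ : X ⟶ Y), IsPreStep F₂ φ → IsPreStep F₁ (Ψ.inverse.map φ))
    (hfrob : ∀ ⦃X Y : C₁⦄ (φ : X ⟶ Y), IsFrobeniusType F₁ φ → IsFrobeniusType F₂ (Ψ.functor.map φ))
    (hfrob' : ∀ ⦃X Y : C₂⦄ (φ : X ⟶ Y), IsFrobeniusType F₂ φ → IsFrobeniusType F₁ (Ψ.inverse.map φ))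
    (hlin : ∀ ⦃X Y : C₁⦄ (φ : X ⟶ Y), IsLinear F₁ φ → IsLinear F₂ (Ψ.functor.map φ))
    (hlin' : ∀ ⦃X Y : C₂⦄ (φ : X ⟶ Y), IsLinear F₂ φ → IsLinear F₁ (Ψ.inverse.map φ))
    (hbi : ∀ ⦃X Y : C₁⦄ (φ : X ⟶ Y), IsBaseIso F₁ φ → IsBaseIso F₂ (Ψ.functor.map φ))
    (hbi' : ∀ ⦃X Y : C₂⦄ (φ : X ⟶ Y), IsBaseIso F₂ φ → IsBaseIso F₁ (Ψ.inverse.map φ))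
    (hpb : ∀ ⦃X Y : C₁⦄ (φ : X ⟶ Y), IsPullbackMorphism F₁ φ → IsPullbackMorphism F₂ (Ψ.functor.map φ))
    (hpb' : ∀ ⦃X Y : C₂⦄ (φ : X ⟶ Y), IsPullbackMorphism F₂ φ → IsPullbackMorphism F₁ (Ψ.inverse.map φ))
    (hprim : ∀ ⦃X Y : C₁⦄ (φ : X ⟶ Y), IsPrimaryPreStep F₁ φ → IsPrimaryPreStep F₂ (Ψ.functor.map φ))
    (hprim' : ∀ ⦃X Y : C₂⦄ (φ : X ⟶ Y), IsPrimaryPreStep F₂ φ → IsPrimaryPreStep F₁ (Ψ.inverse.map φ)) :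
    ∃ ΨBase : D₁ ⥤ D₂, ΨBase.IsEquivalence ∧
      OneCommutes Ψ.functor (PreFrobenioidData.ofFunctor Φ₂ F₂).base (PreFrobenioidData.ofFunctor Φ₁ F₁).base ΨBase := by
  -- co-angular pre-steps (all pre-steps are co-angular in isotropic type)
  have hΨ : ∀ ⦃A B : C₁⦄ (f : A ⟶ B), IsCoAngularPreStep F₁ f → IsCoAngularPreStep F₂ (Ψ.functor.map f) :=
    fun A B f hf => isCoAngularPreStep_of_isotropic hiso₂ (hpre f hf.2)
  have hΨ' : ∀ ⦃A B : C₂⦄ (f : A ⟶ B), IsCoAngularPreStep F₂ f → IsCoAngularPreStep F₁ (Ψ.inverse.map f) :=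
    fun A B f hf => isCoAngularPreStep_of_isotropic hiso₁ (hpre' f hf.2)
  -- `Ψ^birat` (Cor. 4.10) as an equivalence with functor `mapOfEquiv Ψ` and inverse `mapOfEquiv Ψ⁻¹`
  haveI := toBirat_isLocalization hF₁ hsq₁
  haveI := toBirat_isLocalization hF₂ hsq₂
  letI := Birat.liftingMapOfEquiv hF₁ hsq₁ hF₂ hsq₂ Ψ hΨ
  let F' : Birat F₂ hF₂ hsq₂ ⥤ Birat F₁ hF₁ hsq₁ := Birat.mapOfEquiv hF₂ hsq₂ hF₁ hsq₁ Ψ.symm hΨ'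
  let fac' : toBirat F₂ hF₂ hsq₂ ⋙ F' ≅ Ψ.inverse ⋙ toBirat F₁ hF₁ hsq₁ :=
    Birat.mapOfEquivFac hF₂ hsq₂ hF₁ hsq₁ Ψ.symm hΨ'
  letI : Localization.Lifting (toBirat F₂ hF₂ hsq₂) (coAngularPreSteps F₂)
      (Ψ.inverse ⋙ toBirat F₁ hF₁ hsq₁) F' := ⟨fac'⟩
  let α : (Ψ.functor ⋙ toBirat F₂ hF₂ hsq₂) ⋙ F' ≅ toBirat F₁ hF₁ hsq₁ :=
    Functor.associator _ _ _ ≪≫ Functor.isoWhiskerLeft Ψ.functor fac' ≪≫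
      (Functor.associator _ _ _).symm ≪≫ Functor.isoWhiskerRight Ψ.unitIso.symm _ ≪≫
        Functor.leftUnitor _
  let β : (Ψ.inverse ⋙ toBirat F₁ hF₁ hsq₁) ⋙ Birat.mapOfEquiv hF₁ hsq₁ hF₂ hsq₂ Ψ hΨ ≅
      toBirat F₂ hF₂ hsq₂ :=
    Functor.associator _ _ _ ≪≫
      Functor.isoWhiskerLeft Ψ.inverse (Birat.mapOfEquivFac hF₁ hsq₁ hF₂ hsq₂ Ψ hΨ) ≪≫
        (Functor.associator _ _ _).symm ≪≫ Functor.isoWhiskerRight Ψ.counitIso _ ≪≫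
          Functor.leftUnitor _
  let Eb : Birat F₁ hF₁ hsq₁ ≌ Birat F₂ hF₂ hsq₂ :=
    Localization.equivalence (toBirat F₁ hF₁ hsq₁) (coAngularPreSteps F₁) (toBirat F₂ hF₂ hsq₂)
      (coAngularPreSteps F₂) (Ψ.functor ⋙ toBirat F₂ hF₂ hsq₂) (Birat.mapOfEquiv hF₁ hsq₁ hF₂ hsq₂ Ψ hΨ)
      (Ψ.inverse ⋙ toBirat F₁ hF₁ hsq₁) F' α β
  -- Div-slimness and Def. 1.3 (i)(c) for the birationalizations, in the shapes of `isBaseIdentity_map_of_isDivSlim`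
  have hds₁' : ∀ (X : D₁) (a : Aut (Over.forget X)),
      (∀ (V : Over X) (x : Φ₁.obj (op V.left)), pull Φ₁ (a.hom.app V) x = x) → a = 1 :=
    fun X a h => hds₁.eq_one X a fun V x => h V x
  have hds₂' : ∀ (X : D₂) (a : Aut (Over.forget X)),
      (∀ (V : Over X) (x : Φ₂.obj (op V.left)), pull Φ₂ (a.hom.app V) x = x) → a = 1 :=
    fun X a h => hds₂.eq_one X a fun V x => h V x
  have hic₁ := Birat.pullbackSliceToBase_toElemZero_isEquivalence hF₁ hsq₁
  have hic₂ := Birat.pullbackSliceToBase_toElemZero_isEquivalence hF₂ hsq₂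
  -- `Ψ^birat`, `(Ψ⁻¹)^birat` preserve base-isomorphisms (Prop. 4.4 (iv) + Thm. 3.4 (iii)) and pull-backs
  have hbiE : ∀ ⦃X Y : Birat F₁ hF₁ hsq₁⦄ (g : X ⟶ Y), IsBaseIso (Birat.toElemZero hF₁ hsq₁) g →
      IsBaseIso (Birat.toElemZero hF₂ hsq₂) (Eb.functor.map g) :=
    fun X Y g hg => Birat.isBaseIso_mapOfEquiv_map hF₁ hsq₁ hF₂ hsq₂ Ψ hΨ hbi g hg
  have hbiE' : ∀ ⦃X Y : Birat F₂ hF₂ hsq₂⦄ (g : X ⟶ Y), IsBaseIso (Birat.toElemZero hF₂ hsq₂) g →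
      IsBaseIso (Birat.toElemZero hF₁ hsq₁) (Eb.inverse.map g) :=
    fun X Y g hg => Birat.isBaseIso_mapOfEquiv_map hF₂ hsq₂ hF₁ hsq₁ Ψ.symm hΨ' hbi' g hg
  have hpbE : ∀ ⦃X Y : Birat F₁ hF₁ hsq₁⦄ (δ : X ⟶ Y), IsPullbackMorphism (Birat.toElemZero hF₁ hsq₁) δ →
      IsPullbackMorphism (Birat.toElemZero hF₂ hsq₂) (Eb.functor.map δ) :=
    Birat.isPullbackMorphism_mapOfEquiv_map hF₁ hsq₁ hF₂ hsq₂ Ψ hΨ hiso₁ hiso₂ hlin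
  have hpbE' : ∀ ⦃X Y : Birat F₂ hF₂ hsq₂⦄ (δ : X ⟶ Y), IsPullbackMorphism (Birat.toElemZero hF₂ hsq₂) δ →
      IsPullbackMorphism (Birat.toElemZero hF₁ hsq₁) (Eb.inverse.map δ) :=
    Birat.isPullbackMorphism_mapOfEquiv_map hF₂ hsq₂ hF₁ hsq₁ Ψ.symm hΨ' hiso₂ hiso₁ hlin'
  -- Thm. 4.2 (ii) + WEAKLY perf-factorial + non-dilating: base-identity endomorphisms go to `Φ`-identity ones
  have hdi : ∀ (X : Birat F₁ hF₁ hsq₁) (φ : X ⟶ X), IsBaseIdentity (Birat.toElemZero hF₁ hsq₁) φ →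
      pull Φ₂ (Base (Birat.toElemZero hF₂ hsq₂) (Eb.functor.map φ)) = MonoidHom.id _ :=
    fun X φ hφ => Birat.pull_base_mapOfEquiv_map_eq_id'_weak hF₁ hsq₁ hF₂ hsq₂ Ψ hΨ hperf₁ hperf₂ hiso₁ hiso₂
      hpf₁ hpf₂ hnd₂ hpre hpre' hfrob hpb hprim hprim' X φ (pull_base_eq_id_of_isBaseIdentity hφ)
  have hdi' : ∀ (Y : Birat F₂ hF₂ hsq₂) (φ : Y ⟶ Y), IsBaseIdentity (Birat.toElemZero hF₂ hsq₂) φ →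
      pull Φ₁ (Base (Birat.toElemZero hF₁ hsq₁) (Eb.inverse.map φ)) = MonoidHom.id _ :=
    fun Y φ hφ => Birat.pull_base_mapOfEquiv_map_eq_id'_weak hF₂ hsq₂ hF₁ hsq₁ Ψ.symm hΨ' hperf₂ hperf₁ hiso₂
      hiso₁ hpf₂ hpf₁ hnd₁ hpre' hpre hfrob' hpb' hprim' hprim Y φ (pull_base_eq_id_of_isBaseIdentity hφ)
  -- Div-slimness: hence to base-identity ones (p. 93 l. 45)
  have hbid : ∀ (X : Birat F₁ hF₁ hsq₁) (φ : X ⟶ X), IsBaseIdentity (Birat.toElemZero hF₁ hsq₁) φ →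
      IsBaseIdentity (Birat.toElemZero hF₂ hsq₂) (Eb.functor.map φ) :=
    fun X φ hφ => isBaseIdentity_map_of_isDivSlim (Φ₂ := Φ₂) hic₂ hds₂' Eb hbiE hpbE' hdi hφ
  have hbid' : ∀ (Y : Birat F₂ hF₂ hsq₂) (φ : Y ⟶ Y), IsBaseIdentity (Birat.toElemZero hF₂ hsq₂) φ →
      IsBaseIdentity (Birat.toElemZero hF₁ hsq₁) (Eb.inverse.map φ) :=
    fun Y φ hφ => isBaseIdentity_map_of_isDivSlim (Φ₂ := Φ₁) hic₁ hds₁' Eb.symm hbiE' hpbE hdi' hφ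
  exact exists_base_equivalence_of_birat hF₁ hsq₁ hF₂ hsq₂ Ψ hB₁ hB₂ hD₁ hD₂
    (PreFrobenioidData.isOfIsotropicType_ofFunctor_toElemZero hF₁ hsq₁
      ((PreFrobenioidData.ofFunctor_isOfIsotropicType F₁).mpr hiso₁))
    (PreFrobenioidData.isOfIsotropicType_ofFunctor_toElemZero hF₂ hsq₂
      ((PreFrobenioidData.ofFunctor_isOfIsotropicType F₂).mpr hiso₂))
    Eb (Birat.mapOfEquivFac hF₁ hsq₁ hF₂ hsq₂ Ψ hΨ) hbid hbid'

/-- **[FrdI] Cor. 4.11 (ii) AS TYPED in the perfect isotropic case, for WEAKLY perf-factorial `Φ_i`** —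
`exists_base_equivalence_inst_of_perfect_weak` followed by the `1`-uniqueness and rigidity theorems
(`cor411ii_of_exists_base_equivalence'`).  Weak twin of `cor411ii_inst_of_perfect`. [cite: MochizukiFrdI2008, Cor. 4.11 (ii) p.91] -/
theorem cor411ii_inst_of_perfect_weak (hF₁ : IsFrobenioid F₁) (hsq₁ : HasBiratSquares F₁)
    (hF₂ : IsFrobenioid F₂) (hsq₂ : HasBiratSquares F₂) (Ψ : C₁ ≌ C₂)
    (hB₁ : IsFrobenioid (Birat.toElemZero hF₁ hsq₁)) (hB₂ : IsFrobenioid (Birat.toElemZero hF₂ hsq₂))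
    (hD₁ : IsOfFSMFFType D₁) (hD₂ : IsOfFSMFFType D₂)
    (hperf₁ : IsOfPerfectType F₁) (hperf₂ : IsOfPerfectType F₂)
    (hiso₁ : IsOfIsotropicType F₁) (hiso₂ : IsOfIsotropicType F₂)
    (hpf₁ : Objectwise (fun M _ => IsPerfFactorialWeak M) Φ₁)
    (hpf₂ : Objectwise (fun M _ => IsPerfFactorialWeak M) Φ₂)
    (hnd₁ : IsNonDilatingOn Φ₁) (hnd₂ : IsNonDilatingOn Φ₂)
    (hds₁ : (PreFrobenioidData.ofFunctor Φ₁ F₁).IsDivSlim) (hds₂ : (PreFrobenioidData.ofFunctor Φ₂ F₂).IsDivSlim)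
    (hpre : ∀ ⦃X Y : C₁⦄ (φ : X ⟶ Y), IsPreStep F₁ φ → IsPreStep F₂ (Ψ.functor.map φ))
    (hpre' : ∀ ⦃X Y : C₂⦄ (φ : X ⟶ Y), IsPreStep F₂ φ → IsPreStep F₁ (Ψ.inverse.map φ))
    (hfrob : ∀ ⦃X Y : C₁⦄ (φ : X ⟶ Y), IsFrobeniusType F₁ φ → IsFrobeniusType F₂ (Ψ.functor.map φ))
    (hfrob' : ∀ ⦃X Y : C₂⦄ (φ : X ⟶ Y), IsFrobeniusType F₂ φ → IsFrobeniusType F₁ (Ψ.inverse.map φ))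
    (hlin : ∀ ⦃X Y : C₁⦄ (φ : X ⟶ Y), IsLinear F₁ φ → IsLinear F₂ (Ψ.functor.map φ))
    (hlin' : ∀ ⦃X Y : C₂⦄ (φ : X ⟶ Y), IsLinear F₂ φ → IsLinear F₁ (Ψ.inverse.map φ))
    (hbi : ∀ ⦃X Y : C₁⦄ (φ : X ⟶ Y), IsBaseIso F₁ φ → IsBaseIso F₂ (Ψ.functor.map φ))
    (hbi' : ∀ ⦃X Y : C₂⦄ (φ : X ⟶ Y), IsBaseIso F₂ φ → IsBaseIso F₁ (Ψ.inverse.map φ))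
    (hpb : ∀ ⦃X Y : C₁⦄ (φ : X ⟶ Y), IsPullbackMorphism F₁ φ → IsPullbackMorphism F₂ (Ψ.functor.map φ))
    (hpb' : ∀ ⦃X Y : C₂⦄ (φ : X ⟶ Y), IsPullbackMorphism F₂ φ → IsPullbackMorphism F₁ (Ψ.inverse.map φ))
    (hprim : ∀ ⦃X Y : C₁⦄ (φ : X ⟶ Y), IsPrimaryPreStep F₁ φ → IsPrimaryPreStep F₂ (Ψ.functor.map φ))
    (hprim' : ∀ ⦃X Y : C₂⦄ (φ : X ⟶ Y), IsPrimaryPreStep F₂ φ → IsPrimaryPreStep F₁ (Ψ.inverse.map φ)) :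
    (PreFrobenioidData.ofFunctor Φ₁ F₁).Cor411ii (PreFrobenioidData.ofFunctor Φ₂ F₂) Ψ :=
  cor411ii_of_exists_base_equivalence' F₁ F₂ Ψ hF₁ hF₂
    (exists_base_equivalence_inst_of_perfect_weak hF₁ hsq₁ hF₂ hsq₂ Ψ hB₁ hB₂ hD₁ hD₂ hperf₁ hperf₂ hiso₁ hiso₂
      hpf₁ hpf₂ hnd₁ hnd₂ hds₁ hds₂ hpre hpre' hfrob hfrob' hlin hlin' hbi hbi' hpb hpb' hprim hprim')

end PreFrobenioid

/-! ## Over the CLAUSES of the setting of the proof of Thm. 4.2 (no `FrdI.T42.Setting` twin) -/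

namespace FrdI.T42

open PreFrobenioid

variable {D₁ : Type u} [Category.{v} D₁] {Φ₁ : D₁ᵒᵖ ⥤ CommMonCat.{w}} {C₁ : Type u'} [Category.{v'} C₁]
  {D₂ : Type u} [Category.{v} D₂] {Φ₂ : D₂ᵒᵖ ⥤ CommMonCat.{w}} {C₂ : Type u'} [Category.{v'} C₂]
  {F₁ : C₁ ⥤ ElemFrobenioid Φ₁} {F₂ : C₂ ⥤ ElemFrobenioid Φ₂} {Ψ : C₁ ≌ C₂}

/-- Frobenius degrees are invariant under conjugation by isomorphisms; hence `Ψ⁻¹` preserves them when `Ψ` does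
(the clause `degFr_map` of the setting, read for the quasi-inverse — as `degFr_inverse_map`, without the structure).
[cite: MochizukiFrdI2008, Thm. 3.4 (iii) p.62] -/
theorem degFr_inverse_map_of_degFr_map
    (hdeg : ∀ ⦃X Y : C₁⦄ (φ : X ⟶ Y), degFr F₂ (Ψ.functor.map φ) = degFr F₁ φ) ⦃X Y : C₂⦄ (φ : X ⟶ Y) :
    degFr F₁ (Ψ.inverse.map φ) = degFr F₂ φ := by
  -- the counit, with clean object names
  have hεty : ∀ Z : C₂, ∃ e : Ψ.functor.obj (Ψ.inverse.obj Z) ≅ Z, e = Ψ.counitIso.app Z :=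
    fun Z => ⟨_, rfl⟩
  choose ε hε₀ using hεty
  have hε' : Ψ.functor.map (Ψ.inverse.map φ) ≫ (ε Y).hom = (ε X).hom ≫ φ := by
    rw [hε₀ X, hε₀ Y]
    have := Ψ.counitIso.hom.naturality φ
    dsimp at this
    exact this
  have e : Ψ.functor.map (Ψ.inverse.map φ) = (ε X).hom ≫ φ ≫ (ε Y).symm.hom := by
    rw [Iso.symm_hom, ← Category.assoc, ← hε', Category.assoc, Iso.hom_inv_id, Category.comp_id]
  have h := hdeg (Ψ.inverse.map φ)
  rw [e, PreFrobenioid.degFr_comp, PreFrobenioid.degFr_comp, PreFrobenioid.degFr_iso_hom F₂ (ε X),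
    PreFrobenioid.degFr_iso_hom F₂ (ε Y).symm, one_mul, mul_one] at h
  exact h.symm

set_option backward.isDefEq.respectTransparency false in
/-- **The base square of [FrdI] Cor. 4.11 (ii) over the CLAUSES of the setting of the proof of Thm. 4.2, for WEAKLY
perf-factorial `Φ_i`**: Frobenioids of perfect and isotropic type, `Φ_i` weakly perf-factorial, the conclusions of Thm.
3.4 (ii)(iii) for `Ψ`, `Ψ⁻¹` (pre-steps, Frobenius type, Frobenius degrees, pull-backs) as explicit binders — the fields of
`FrdI.T42.Setting` with `perfFactorial_i` weakened (the structure itself is not twinned) —, given in addition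
`HasBiratSquares` and the Frobenioid structures of the birationalizations (Prop. 4.4 (ii)), bases of FSMFF-type Div-slim
relative to the non-dilating `Φ_i`, and "`Ψ`, `Ψ⁻¹` preserve primary pre-steps" (Thm. 4.2 (i)).  Base-isomorphisms =
Frobenius type ≫ pre-step (Prop. 1.7 (ii)) and linear = Frobenius degree `1` reduce the remaining clauses, as in
`exists_base_equivalence_inst_of_setting`. [cite: MochizukiFrdI2008, Cor. 4.11 (ii) p.91] -/
theorem exists_base_equivalence_inst_of_clauses_weak
    (hF₁ : IsFrobenioid F₁) (hF₂ : IsFrobenioid F₂)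
    (hperf₁ : IsOfPerfectType F₁) (hperf₂ : IsOfPerfectType F₂)
    (hiso₁ : IsOfIsotropicType F₁) (hiso₂ : IsOfIsotropicType F₂)
    (hpf₁ : Objectwise (fun M _ => IsPerfFactorialWeak M) Φ₁)
    (hpf₂ : Objectwise (fun M _ => IsPerfFactorialWeak M) Φ₂)
    (hpre : ∀ ⦃X Y : C₁⦄ (φ : X ⟶ Y), IsPreStep F₁ φ → IsPreStep F₂ (Ψ.functor.map φ))
    (hpre' : ∀ ⦃X Y : C₂⦄ (φ : X ⟶ Y), IsPreStep F₂ φ → IsPreStep F₁ (Ψ.inverse.map φ))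
    (hfrob : ∀ ⦃X Y : C₁⦄ (φ : X ⟶ Y), IsFrobeniusType F₁ φ → IsFrobeniusType F₂ (Ψ.functor.map φ))
    (hfrob' : ∀ ⦃X Y : C₂⦄ (φ : X ⟶ Y), IsFrobeniusType F₂ φ → IsFrobeniusType F₁ (Ψ.inverse.map φ))
    (hdeg : ∀ ⦃X Y : C₁⦄ (φ : X ⟶ Y), degFr F₂ (Ψ.functor.map φ) = degFr F₁ φ)
    (hpb : ∀ ⦃X Y : C₁⦄ (φ : X ⟶ Y), IsPullbackMorphism F₁ φ → IsPullbackMorphism F₂ (Ψ.functor.map φ))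
    (hpb' : ∀ ⦃X Y : C₂⦄ (φ : X ⟶ Y), IsPullbackMorphism F₂ φ → IsPullbackMorphism F₁ (Ψ.inverse.map φ))
    (hsq₁ : HasBiratSquares F₁) (hsq₂ : HasBiratSquares F₂)
    (hB₁ : IsFrobenioid (Birat.toElemZero hF₁ hsq₁))
    (hB₂ : IsFrobenioid (Birat.toElemZero hF₂ hsq₂))
    (hD₁ : IsOfFSMFFType D₁) (hD₂ : IsOfFSMFFType D₂)
    (hnd₁ : IsNonDilatingOn Φ₁) (hnd₂ : IsNonDilatingOn Φ₂)
    (hds₁ : (PreFrobenioidData.ofFunctor Φ₁ F₁).IsDivSlim) (hds₂ : (PreFrobenioidData.ofFunctor Φ₂ F₂).IsDivSlim)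
    (hprim : ∀ ⦃X Y : C₁⦄ (φ : X ⟶ Y), IsPrimaryPreStep F₁ φ → IsPrimaryPreStep F₂ (Ψ.functor.map φ))
    (hprim' : ∀ ⦃X Y : C₂⦄ (φ : X ⟶ Y), IsPrimaryPreStep F₂ φ → IsPrimaryPreStep F₁ (Ψ.inverse.map φ)) :
    ∃ ΨBase : D₁ ⥤ D₂, ΨBase.IsEquivalence ∧
      OneCommutes Ψ.functor (PreFrobenioidData.ofFunctor Φ₂ F₂).base (PreFrobenioidData.ofFunctor Φ₁ F₁).base
        ΨBase := by
  -- linear morphisms: Frobenius degree `1`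
  have hlin : ∀ ⦃X Y : C₁⦄ (φ : X ⟶ Y), IsLinear F₁ φ → IsLinear F₂ (Ψ.functor.map φ) := by
    intro X Y φ hφ
    change degFr F₂ (Ψ.functor.map φ) = 1
    rw [hdeg]
    exact hφ
  have hlin' : ∀ ⦃X Y : C₂⦄ (φ : X ⟶ Y), IsLinear F₂ φ → IsLinear F₁ (Ψ.inverse.map φ) := by
    intro X Y φ hφ
    change degFr F₁ (Ψ.inverse.map φ) = 1
    rw [degFr_inverse_map_of_degFr_map hdeg]
    exact hφ
  -- base-isomorphisms: Frobenius type ≫ pre-step (Prop. 1.7 (ii))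
  have hbi : ∀ ⦃X Y : C₁⦄ (φ : X ⟶ Y), IsBaseIso F₁ φ → IsBaseIso F₂ (Ψ.functor.map φ) := by
    intro X Y φ hφ
    obtain ⟨Z, b, a, hfac, hb, ha⟩ := (isBaseIso_iff_exists_frobeniusType_preStep F₁ hF₁ φ).mp hφ
    rw [← hfac, Functor.map_comp]
    haveI : IsIso (Base F₂ (Ψ.functor.map b)) := (hfrob b hb).2
    haveI : IsIso (Base F₂ (Ψ.functor.map a)) := (hpre a ha).2
    change IsIso (Base F₂ (Ψ.functor.map b ≫ Ψ.functor.map a))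
    rw [base_comp]
    infer_instance
  have hbi' : ∀ ⦃X Y : C₂⦄ (φ : X ⟶ Y), IsBaseIso F₂ φ → IsBaseIso F₁ (Ψ.inverse.map φ) := by
    intro X Y φ hφ
    obtain ⟨Z, b, a, hfac, hb, ha⟩ := (isBaseIso_iff_exists_frobeniusType_preStep F₂ hF₂ φ).mp hφ
    rw [← hfac, Functor.map_comp]
    haveI : IsIso (Base F₁ (Ψ.inverse.map b)) := (hfrob' b hb).2
    haveI : IsIso (Base F₁ (Ψ.inverse.map a)) := (hpre' a ha).2
    change IsIso (Base F₁ (Ψ.inverse.map b ≫ Ψ.inverse.map a))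
    rw [base_comp]
    infer_instance
  exact exists_base_equivalence_inst_of_perfect_weak hF₁ hsq₁ hF₂ hsq₂ Ψ hB₁ hB₂ hD₁ hD₂ hperf₁ hperf₂ hiso₁
    hiso₂ hpf₁ hpf₂ hnd₁ hnd₂ hds₁ hds₂ hpre hpre' hfrob hfrob' hlin hlin' hbi hbi' hpb hpb' hprim hprim'

/-- **[FrdI] Cor. 4.11 (ii) AS TYPED over the clauses of the setting of the proof of Thm. 4.2, for WEAKLY
perf-factorial `Φ_i`** — `exists_base_equivalence_inst_of_clauses_weak` followed by the `1`-uniqueness and rigidity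
theorems (`cor411ii_of_exists_base_equivalence'`).  Weak, structure-free twin of `cor411ii_inst_of_setting`.
[cite: MochizukiFrdI2008, Cor. 4.11 (ii) p.91] -/
theorem cor411ii_inst_of_clauses_weak
    (hF₁ : IsFrobenioid F₁) (hF₂ : IsFrobenioid F₂)
    (hperf₁ : IsOfPerfectType F₁) (hperf₂ : IsOfPerfectType F₂)
    (hiso₁ : IsOfIsotropicType F₁) (hiso₂ : IsOfIsotropicType F₂)
    (hpf₁ : Objectwise (fun M _ => IsPerfFactorialWeak M) Φ₁)
    (hpf₂ : Objectwise (fun M _ => IsPerfFactorialWeak M) Φ₂)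
    (hpre : ∀ ⦃X Y : C₁⦄ (φ : X ⟶ Y), IsPreStep F₁ φ → IsPreStep F₂ (Ψ.functor.map φ))
    (hpre' : ∀ ⦃X Y : C₂⦄ (φ : X ⟶ Y), IsPreStep F₂ φ → IsPreStep F₁ (Ψ.inverse.map φ))
    (hfrob : ∀ ⦃X Y : C₁⦄ (φ : X ⟶ Y), IsFrobeniusType F₁ φ → IsFrobeniusType F₂ (Ψ.functor.map φ))
    (hfrob' : ∀ ⦃X Y : C₂⦄ (φ : X ⟶ Y), IsFrobeniusType F₂ φ → IsFrobeniusType F₁ (Ψ.inverse.map φ))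
    (hdeg : ∀ ⦃X Y : C₁⦄ (φ : X ⟶ Y), degFr F₂ (Ψ.functor.map φ) = degFr F₁ φ)
    (hpb : ∀ ⦃X Y : C₁⦄ (φ : X ⟶ Y), IsPullbackMorphism F₁ φ → IsPullbackMorphism F₂ (Ψ.functor.map φ))
    (hpb' : ∀ ⦃X Y : C₂⦄ (φ : X ⟶ Y), IsPullbackMorphism F₂ φ → IsPullbackMorphism F₁ (Ψ.inverse.map φ))
    (hsq₁ : HasBiratSquares F₁) (hsq₂ : HasBiratSquares F₂)
    (hB₁ : IsFrobenioid (Birat.toElemZero hF₁ hsq₁))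
    (hB₂ : IsFrobenioid (Birat.toElemZero hF₂ hsq₂))
    (hD₁ : IsOfFSMFFType D₁) (hD₂ : IsOfFSMFFType D₂)
    (hnd₁ : IsNonDilatingOn Φ₁) (hnd₂ : IsNonDilatingOn Φ₂)
    (hds₁ : (PreFrobenioidData.ofFunctor Φ₁ F₁).IsDivSlim) (hds₂ : (PreFrobenioidData.ofFunctor Φ₂ F₂).IsDivSlim)
    (hprim : ∀ ⦃X Y : C₁⦄ (φ : X ⟶ Y), IsPrimaryPreStep F₁ φ → IsPrimaryPreStep F₂ (Ψ.functor.map φ))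
    (hprim' : ∀ ⦃X Y : C₂⦄ (φ : X ⟶ Y), IsPrimaryPreStep F₂ φ → IsPrimaryPreStep F₁ (Ψ.inverse.map φ)) :
    (PreFrobenioidData.ofFunctor Φ₁ F₁).Cor411ii (PreFrobenioidData.ofFunctor Φ₂ F₂) Ψ :=
  cor411ii_of_exists_base_equivalence' F₁ F₂ Ψ hF₁ hF₂
    (exists_base_equivalence_inst_of_clauses_weak hF₁ hF₂ hperf₁ hperf₂ hiso₁ hiso₂ hpf₁ hpf₂ hpre hpre' hfrob hfrob'
      hdeg hpb hpb' hsq₁ hsq₂ hB₁ hB₂ hD₁ hD₂ hnd₁ hnd₂ hds₁ hds₂ hprim hprim')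

/-- The printed case is recovered: `FrdI.T42.Setting` (perf-factorial fields as printed) feeds the weak, structure-free
theorem through `IsPerfFactorial.weak` — a record that the weakening is genuine and loses nothing.
[cite: MochizukiFrdI2008, Cor. 4.11 (ii) p.91] -/
example (S : Setting F₁ F₂ Ψ)
    (hsq₁ : HasBiratSquares F₁) (hsq₂ : HasBiratSquares F₂)
    (hB₁ : IsFrobenioid (Birat.toElemZero S.isFrobenioid₁ hsq₁))
    (hB₂ : IsFrobenioid (Birat.toElemZero S.isFrobenioid₂ hsq₂))
    (hD₁ : IsOfFSMFFType D₁) (hD₂ : IsOfFSMFFType D₂)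
    (hnd₁ : IsNonDilatingOn Φ₁) (hnd₂ : IsNonDilatingOn Φ₂)
    (hds₁ : (PreFrobenioidData.ofFunctor Φ₁ F₁).IsDivSlim) (hds₂ : (PreFrobenioidData.ofFunctor Φ₂ F₂).IsDivSlim)
    (hprim : ∀ ⦃X Y : C₁⦄ (φ : X ⟶ Y), IsPrimaryPreStep F₁ φ → IsPrimaryPreStep F₂ (Ψ.functor.map φ))
    (hprim' : ∀ ⦃X Y : C₂⦄ (φ : X ⟶ Y), IsPrimaryPreStep F₂ φ → IsPrimaryPreStep F₁ (Ψ.inverse.map φ)) :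
    (PreFrobenioidData.ofFunctor Φ₁ F₁).Cor411ii (PreFrobenioidData.ofFunctor Φ₂ F₂) Ψ :=
  cor411ii_inst_of_clauses_weak S.isFrobenioid₁ S.isFrobenioid₂ S.perfect₁ S.perfect₂ S.isotropic₁ S.isotropic₂
    (fun X => (S.perfFactorial₁ X).weak) (fun X => (S.perfFactorial₂ X).weak) S.preStep_map S.preStep_inv
    S.frobeniusType_map S.frobeniusType_inv S.degFr_map S.pullback_map S.pullback_inv hsq₁ hsq₂ hB₁ hB₂ hD₁ hD₂
    hnd₁ hnd₂ hds₁ hds₂ hprim hprim'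

end FrdI.T42

end Literature.AlgebraicGeometry.Frobenioids
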